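/-
Copyright (c) 2026 the pub-hodgecm-mathlib formalisation cell (harness21).  Prover seat hodgecm-mathlib-K2Liu-p13 (g4), Track B «K2-LIT»,
#184♮ = hLiu418 = `stmt-HodgeConjecture-24832`; ROAD Φ (RULING «M-156n»), #41 TOP — brick (E3) of the (β) census `CENSUS-Beta-EulerFace.K2Liu-p13-g4.md`:
THE EULER HEAD OF THE BIG CELL `M(s)f_s(h)` FOR THE SOCKET'S OWN DATA (`𝒦.IsStd`, `IsStandardSectionFamily 𝒦 χ f`, `∀ s, Continuous (f s)`, unitary `χ`) —
★ Φ3d (d2) `whittakerDelta_eq_mul_tprod_of_isFactorizableOff` at the index `S = 0` with EVERY section-side and measure letter discharged by name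
(★ Φ3a level, ★ #31s factorisation, ★ (S4-good) local Iwasawa a.e., ★ `isUnramifiedAt_cofinite`, ★ O41.3 integrability, ★ Φ3b pinned splitting).
THEOREMS ONLY (no `def`, no `instance`, no named-fact hypothesis, no `sorry`).
-/
import Summits.HodgeConjecture.HodgeConjecture.Theorems.K2LiuWhittakerDeltaIntegrandFactorisation   -- ★ Φ3d (d2) `whittakerDelta_eq_mul_tprod_of_isFactorizableOff`
import Summits.HodgeConjecture.HodgeConjecture.Theorems.K2LiuStdFamilyFactorisable                   -- ★ #31s `stdFamilyFactorisable`
import Summits.HodgeConjecture.HodgeConjecture.Theorems.K2LiuStdDatumLevelOffS                       -- ★ Φ3a `exists_finset_level_of_isStandardSectionFamily`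
import Summits.HodgeConjecture.HodgeConjecture.Theorems.K2LiuSWGeneratorGoodPlaces                   -- ★ (S4-good) `eventually_forall_exists_siegelDelta_mul_localInt` (+ cofinite unramifiedness)
import Summits.HodgeConjecture.HodgeConjecture.Theorems.K2LiuIntertwiningConverges                   -- ★ O41.3 `integrable_weylDelta_mul`
import HarnessLib

/-!
# Crux `HLiu418`, ROAD Φ, organ Φ8 (row G6) ∕ Φ3d at index 0: THE EULER HEAD OF THE BIG CELL FOR THE SOCKET'S STANDARD FAMILY

Cell `hodgecm-mathlib`, crux item hLiu418 = `stmt-HodgeConjecture-24832` (helper lane, count-neutral).  Doubled frame `H(𝔸) = HA L e dV hdV dW hdW`, a STANDARD Iwasawa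
datum `𝒦` (★ `IwasawaDatum.IsStd`), a unitary Hecke character `χ`, a `𝒦`-standard family `f` with continuous members, a point `h ∈ H(𝔸)`; Haar `νN` on `N_Δ(𝔸)` and local
Haar measures `ν_v` on the `N_Δ(L⁺_v)` with `ν_v(K_{H,v} ∩ N_Δ(L⁺_v)) = 1` off the exceptional set.
**`exists_eulerHead_intertwiningDelta`**: there is a finite set `T₀` of finite places of `L⁺` (level of `f` ★ Φ3a, ramification of `χ`, the bad places of the local Iwasawa
decomposition, the places where `h_v ∉ K_{H,v}` or `(w_Δ)_v ∉ K_{H,v}`) such that for EVERY finite `T ⊇ T₀` and every such `(νN, ν)` there is a σ-finite Haar measure `ν_∞`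
on `N_Δ(L⁺ ⊗ ℝ)` (★ Φ3b, depending on `(νN, ν, T)` only) with, on the convergence half-plane `re s > n∕2`,
`M(s)f_s(h) = (∫ f_s(placesEmbed_T(w_Δ p_∞ h_∞, (w_Δ p_v h_v)_{v∈T})) d(ν_∞ ⊗ ⊗_{v∈T} ν_v)(p)) · ∏'_{v∉T} ∫_{N_Δ(L⁺_v)} Λ_{s,v}((w_Δ)_v y) dν_v(y)`
— the `T`-block times the restricted Euler product of the SPHERICAL local intertwining integrals (`Λ_{s,v}` = ★ `LambdaLoc`).  Proof: ★ Φ3a gives the level `K^T_H ⊆ 𝒦.K`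
and the right-`K^T_H`-invariance of `f_0`; ★ #31s then factorises `f` off `T`; ★ Φ3d (d2) at the index `0` (`ψ_0 ≡ 1`, ★ `unipDeltaChar_zero`, ★ `whittakerDelta_zero_index`)
with `G ∈ L¹` by ★ O41.3 and the measure splitting by ★ Φ3b.  This is brick (E3) of the (β) letter of the #41 TOP (census `K2/K2Liu-p13/g4/CENSUS-Beta-EulerFace…md`);
the same assembly at an index `S ≠ 0` is KIND W's `hRK`.  What (β) still needs after it, by name: the spherical Gindikin–Karpelevich VALUE of the local factor at `n = 2`
(E4), the `T`-block as a flat sum of pure tensors (E6), the `aNorm`-junction (E7), the archimedean block (E8) — then ★ `K2LiuBigCellContinuationOfFaces`.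
Sources: [KudlaRallis1994, §1–§2]; [Tan1999, §2–§3]; [Liu2011, §2B p. 862]; [BorelJacquet1979, §4.1]; [CasselsFrohlichANT1967, Ch. XV §3.3].
HONEST LABEL.  Helper lemmas, count-neutral; `HC_CM` is proved only modulo the 7 printed citations (2 remaining named inputs:
hLiu418 = `stmt-HodgeConjecture-24832`, h413 = `stmt-HodgeConjecture-24833`) until rung 0 closes.
-/

set_option autoImplicit false
set_option linter.dupNamespace false -- the mandated namespace repeats `HodgeConjecture.HodgeConjecture`

noncomputable section

open scoped Matrix RestrictedProduct ENNReal NNReal Topology ComplexConjugate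
open NumberField IsDedekindDomain MeasureTheory Measure Filter Set

namespace Summit.HodgeConjecture.HodgeConjecture.Cruxes.HLiu418.K2LiuBigCellEulerHead

open Literature.NumberTheory.Automorphic Literature.NumberTheory.GaloisRepresentations
open Literature.NumberTheory.GelbartRogawski1991 Literature.NumberTheory.GelbartRogawski1991.GRConstruction
open Literature.NumberTheory.K2Lit.SiegelDoubled
open Literature.NumberTheory.K2Lit.PlaceSplitting
open Literature.MeasureTheory.RestrictedProduct
open Literature.Topology.Algebra.RestrictedProduct (inH)
open Summit.HodgeConjecture.HodgeConjecture.Cruxes.HLiu418.K2LiuSiegelUnipotentLocalDefs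
open Summit.HodgeConjecture.HodgeConjecture.Cruxes.HLiu418.K2LiuSiegelUnipotentSplitDefs
open Summit.HodgeConjecture.HodgeConjecture.Cruxes.HLiu418.K2LiuSiegelUnipotentSplitAtDefs
open Summit.HodgeConjecture.HodgeConjecture.Cruxes.HLiu418.K2LiuSiegelUnipotentHaarPinned
open Summit.HodgeConjecture.HodgeConjecture.Cruxes.HLiu418.K2LiuSiegelUnipotentFourierDefs
open Summit.HodgeConjecture.HodgeConjecture.Cruxes.HLiu418.K2LiuWhittakerDeltaIntegrandFactorisation (whittakerDelta_eq_mul_tprod_of_isFactorizableOff)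
open Summit.HodgeConjecture.HodgeConjecture.Cruxes.HLiu418.K2LiuStdFamilyFactorisable (stdFamilyFactorisable)
open Summit.HodgeConjecture.HodgeConjecture.Cruxes.HLiu418.K2LiuStdDatumLevelOffS (exists_finset_level_of_isStandardSectionFamily)
open Summit.HodgeConjecture.HodgeConjecture.Cruxes.HLiu418.K2LiuSWGeneratorGoodPlaces (eventually_forall_exists_siegelDelta_mul_localInt)
open Summit.HodgeConjecture.HodgeConjecture.Cruxes.HLiu418.K2LiuIntertwiningConverges (integrable_weylDelta_mul)

variable (L : Type) [Field L] [NumberField L] [IsCMField L]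
variable {N M n : ℕ} (e : Fin N × Fin M ≃ Fin n)
  (dV : Fin N → L) (hdV : ∀ i, IsCMField.complexConj L (dV i) = dV i)
  (dW : Fin M → L) (hdW : ∀ i, IsCMField.complexConj L (dW i) = dW i)
  [DecidableEq (HeightOneSpectrum (𝓞 (Fp L)))]

variable [MeasurableSpace ↥(unipDelta L e dV hdV dW hdW)] [BorelSpace ↥(unipDelta L e dV hdV dW hdW)]
  [MeasurableSpace ↥(unipDeltaArch L e dV hdV dW hdW)] [BorelSpace ↥(unipDeltaArch L e dV hdV dW hdW)]
  [∀ v : HeightOneSpectrum (𝓞 (Fp L)), MeasurableSpace ↥(unipDeltaLoc L e dV hdV dW hdW v)] [∀ v : HeightOneSpectrum (𝓞 (Fp L)), BorelSpace ↥(unipDeltaLoc L e dV hdV dW hdW v)]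

/-! ## §1 Cofinite guards: the components of a fixed adelic point are integral off a finite set -/

omit [DecidableEq (HeightOneSpectrum (𝓞 (Fp L)))] [MeasurableSpace ↥(unipDelta L e dV hdV dW hdW)] [BorelSpace ↥(unipDelta L e dV hdV dW hdW)]
  [MeasurableSpace ↥(unipDeltaArch L e dV hdV dW hdW)] [BorelSpace ↥(unipDeltaArch L e dV hdV dW hdW)]
  [∀ v : HeightOneSpectrum (𝓞 (Fp L)), MeasurableSpace ↥(unipDeltaLoc L e dV hdV dW hdW v)] [∀ v : HeightOneSpectrum (𝓞 (Fp L)), BorelSpace ↥(unipDeltaLoc L e dV hdV dW hdW v)] in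
/-- **`x_v ∈ K_{H,v}` off a finite set**, for every `x ∈ H(𝔸)` (the restricted product, ★ `UnitaryGroup.eventually_evalPlace_mem_localInt`), as a `Finset` guard.
[cite: BorelJacquet1979, §4.1] -/
theorem exists_finset_evalPlace_mem_localInt (x : HA L e dV hdV dW hdW) :
    ∃ T : Finset (HeightOneSpectrum (𝓞 (Fp L))), ∀ v, v ∉ T →
      UnitaryGroup.evalPlace (Fp L) L (IsCMField.complexConj L) (n + n) (hermD L e dV hdV dW hdW) v
          (UnitaryGroup.finPart (Fp L) L (IsCMField.complexConj L) (n + n) (hermD L e dV hdV dW hdW) x) ∈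
        UnitaryGroup.localInt L (IsCMField.complexConj L) (n + n) (hermD L e dV hdV dW hdW) v :=
  ⟨(Filter.eventually_cofinite.1 (UnitaryGroup.eventually_evalPlace_mem_localInt (Fp L) L (IsCMField.complexConj L) (n + n)
      (hermD L e dV hdV dW hdW) (UnitaryGroup.finPart (Fp L) L (IsCMField.complexConj L) (n + n) (hermD L e dV hdV dW hdW) x))).toFinset,
    fun v hv => by
      by_contra h1
      exact hv ((Set.Finite.mem_toFinset _).2 h1)⟩

/-! ## §2 The Euler head of the big cell for the socket's data -/

set_option maxHeartbeats 800000 in -- MEASURED (fails at 400 000, passes at 800 000): ★ #31s + ★ Φ3d (d2) + ★ Φ3b in ONE statement on the doubled datum's binder telescope (`whnf` of the statement); plain `obtain`∕`exact`∕`simp only`, no search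
/-- **THE EULER HEAD OF THE BIG CELL `M(s)f_s(h)` FOR THE SOCKET'S STANDARD FAMILY.**  `𝒦` standard, `χ` unitary, `f` a `𝒦`-standard family with continuous members,
`h ∈ H(𝔸)`.  There is a finite `T₀` such that for every finite `T ⊇ T₀`, every Haar `νN` on `N_Δ(𝔸)` and local Haar measures `ν_v` with `ν_v(K_{H,v} ∩ N_Δ(L⁺_v)) = 1`
off `T`, there is a σ-finite Haar `ν_∞` on `N_Δ(L⁺ ⊗ ℝ)` with, for `re s > n∕2`:
`M(s)f_s(h) = (∫ f_s(placesEmbed_T(w_Δ p_∞ h_∞, (w_Δ p_v h_v)_{v∈T})) d(ν_∞ ⊗ ⊗_{v∈T}ν_v)(p)) · ∏'_{v∉T} ∫ Λ_{s,v}((w_Δ)_v y) dν_v(y)`.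
[cite: KudlaRallis1994, §1–§2] [cite: Tan1999, §2–§3] [cite: Liu2011, §2B p. 862] [cite: BorelJacquet1979, §4.1] [cite: CasselsFrohlichANT1967, Ch. XV §3.3 Thm. 3.3.1] -/
theorem exists_eulerHead_intertwiningDelta (hdV0 : ∀ i, dV i ≠ 0) (hdW0 : ∀ i, dW i ≠ 0)
    {𝒦 : IwasawaDatum L e dV hdV dW hdW} (h𝒦 : 𝒦.IsStd) {χ : HeckeCharacter L} (hχu : χ.IsUnitary)
    {f : ℂ → HA L e dV hdV dW hdW → ℂ} (hstd : IsStandardSectionFamily 𝒦 χ f) (hcont : ∀ s, Continuous (f s)) (h : HA L e dV hdV dW hdW) :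
    ∃ T₀ : Finset (HeightOneSpectrum (𝓞 (Fp L))), ∀ T : Finset (HeightOneSpectrum (𝓞 (Fp L))), T₀ ⊆ T →
      ∀ (νN : Measure ↥(unipDelta L e dV hdV dW hdW)) [νN.IsHaarMeasure]
        (νv : ∀ v : HeightOneSpectrum (𝓞 (Fp L)), Measure ↥(unipDeltaLoc L e dV hdV dW hdW v)) [∀ v, (νv v).IsHaarMeasure] [∀ v, SigmaFinite (νv v)],
        (∀ v, v ∉ T → νv v (((inH (fun v => UnitaryGroup.localInt L (IsCMField.complexConj L) (n + n) (hermD L e dV hdV dW hdW) v) (fun v => unipDeltaLoc L e dV hdV dW hdW v) v) : Subgroup ↥(unipDeltaLoc L e dV hdV dW hdW v)) : Set ↥(unipDeltaLoc L e dV hdV dW hdW v)) = 1) →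
        ∃ νinf : Measure ↥(unipDeltaArch L e dV hdV dW hdW), νinf.IsHaarMeasure ∧ SigmaFinite νinf ∧
          ∀ s : ℂ, (n : ℝ) / 2 < s.re →
            intertwiningDelta L e dV hdV dW hdW νN (f s) h =
              (∫ p, f s (placesEmbed L (hermD L e dV hdV dW hdW) T
                  (UnitaryGroup.archPart (Fp L) L (IsCMField.complexConj L) (n + n) (hermD L e dV hdV dW hdW) (weylDelta L e dV hdV dW hdW) *
                      (p.1 : UnitaryGroup.arch (Fp L) L (IsCMField.complexConj L) (n + n) (hermD L e dV hdV dW hdW)) *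
                      UnitaryGroup.archPart (Fp L) L (IsCMField.complexConj L) (n + n) (hermD L e dV hdV dW hdW) h,
                    fun v : T => UnitaryGroup.evalPlace (Fp L) L (IsCMField.complexConj L) (n + n) (hermD L e dV hdV dW hdW) v.1
                        (UnitaryGroup.finPart (Fp L) L (IsCMField.complexConj L) (n + n) (hermD L e dV hdV dW hdW) (weylDelta L e dV hdV dW hdW)) *
                      ((p.2 v : ↥(unipDeltaLoc L e dV hdV dW hdW v.1)) : UnitaryGroup.localPi L (IsCMField.complexConj L) (n + n) (hermD L e dV hdV dW hdW) v.1) *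
                      UnitaryGroup.evalPlace (Fp L) L (IsCMField.complexConj L) (n + n) (hermD L e dV hdV dW hdW) v.1
                        (UnitaryGroup.finPart (Fp L) L (IsCMField.complexConj L) (n + n) (hermD L e dV hdV dW hdW) h)))
                ∂(νinf.prod (Measure.pi fun v : T => νv v.1))) *
              ∏' v : {v : HeightOneSpectrum (𝓞 (Fp L)) // v ∉ T},
                ∫ y, LambdaLoc L e dV hdV dW hdW v.1 χ s
                    (UnitaryGroup.evalPlace (Fp L) L (IsCMField.complexConj L) (n + n) (hermD L e dV hdV dW hdW) v.1
                        (UnitaryGroup.finPart (Fp L) L (IsCMField.complexConj L) (n + n) (hermD L e dV hdV dW hdW) (weylDelta L e dV hdV dW hdW)) *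
                      (y : UnitaryGroup.localPi L (IsCMField.complexConj L) (n + n) (hermD L e dV hdV dW hdW) v.1)) ∂(νv v.1) := by
  -- the five cofinite guards: level (★ Φ3a), `χ` unramified, local Iwasawa (★ S4-good), `h_v ∈ K_{H,v}`, `(w_Δ)_v ∈ K_{H,v}`
  obtain ⟨S₁, hS₁⟩ := exists_finset_level_of_isStandardSectionFamily L e dV hdV dW hdW h𝒦 hstd hcont 0
  obtain ⟨T₂, hT₂⟩ : ∃ T₂ : Finset (HeightOneSpectrum (𝓞 (Fp L))), ∀ v ∉ T₂, ∀ w : UnitaryGroup.PlacesOver L v, χ.IsUnramifiedAt w.1 :=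
    ⟨(Filter.eventually_cofinite.1 (UnitaryGroup.eventually_forall_placesOver (F := Fp L) L (Q := fun w => χ.IsUnramifiedAt w)
        (HeckeCharacter.isUnramifiedAt_cofinite_holds χ))).toFinset,
      fun v hv => by
        by_contra h1
        exact hv ((Set.Finite.mem_toFinset _).2 h1)⟩
  obtain ⟨T₃, hT₃⟩ : ∃ T₃ : Finset (HeightOneSpectrum (𝓞 (Fp L))), ∀ v ∉ T₃, ∀ x : UnitaryGroup.localPi L (IsCMField.complexConj L) (n + n) (hermD L e dV hdV dW hdW) v,
      ∃ p ∈ siegelDeltaLoc L e dV hdV dW hdW v, ∃ k ∈ UnitaryGroup.localInt L (IsCMField.complexConj L) (n + n) (hermD L e dV hdV dW hdW) v, x = p * k :=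
    ⟨(Filter.eventually_cofinite.1 (eventually_forall_exists_siegelDelta_mul_localInt L e dV hdV hdV0 dW hdW hdW0)).toFinset, fun v hv => by
      by_contra h1
      exact hv ((Set.Finite.mem_toFinset _).2 h1)⟩
  obtain ⟨T₄, hT₄⟩ := exists_finset_evalPlace_mem_localInt L e dV hdV dW hdW h
  obtain ⟨T₅, hT₅⟩ := exists_finset_evalPlace_mem_localInt L e dV hdV dW hdW (weylDelta L e dV hdV dW hdW)
  refine ⟨S₁ ∪ T₂ ∪ T₃ ∪ T₄ ∪ T₅, fun T hT νN _ νv _ _ hνK => ?_⟩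
  have hS₁T : S₁ ⊆ T := fun v hv => hT (by simp only [Finset.mem_union]; exact Or.inl (Or.inl (Or.inl (Or.inl hv))))
  have hχT : ∀ v, v ∉ T → ∀ w : UnitaryGroup.PlacesOver L v, χ.IsUnramifiedAt w.1 :=
    fun v hv => hT₂ v fun h2 => hv (hT (by simp only [Finset.mem_union]; exact Or.inl (Or.inl (Or.inl (Or.inr h2)))))
  have hIwT : ∀ v, v ∉ T → ∀ x : UnitaryGroup.localPi L (IsCMField.complexConj L) (n + n) (hermD L e dV hdV dW hdW) v,
      ∃ p ∈ siegelDeltaLoc L e dV hdV dW hdW v, ∃ k ∈ UnitaryGroup.localInt L (IsCMField.complexConj L) (n + n) (hermD L e dV hdV dW hdW) v, x = p * k :=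
    fun v hv => hT₃ v fun h3 => hv (hT (by simp only [Finset.mem_union]; exact Or.inl (Or.inl (Or.inr h3))))
  have hhT : ∀ v, v ∉ T → UnitaryGroup.evalPlace (Fp L) L (IsCMField.complexConj L) (n + n) (hermD L e dV hdV dW hdW) v
      (UnitaryGroup.finPart (Fp L) L (IsCMField.complexConj L) (n + n) (hermD L e dV hdV dW hdW) h) ∈
        UnitaryGroup.localInt L (IsCMField.complexConj L) (n + n) (hermD L e dV hdV dW hdW) v :=
    fun v hv => hT₄ v fun h4 => hv (hT (by simp only [Finset.mem_union]; exact Or.inl (Or.inr h4)))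
  have hwT : ∀ v, v ∉ T → UnitaryGroup.evalPlace (Fp L) L (IsCMField.complexConj L) (n + n) (hermD L e dV hdV dW hdW) v
      (UnitaryGroup.finPart (Fp L) L (IsCMField.complexConj L) (n + n) (hermD L e dV hdV dW hdW) (weylDelta L e dV hdV dW hdW)) ∈
        UnitaryGroup.localInt L (IsCMField.complexConj L) (n + n) (hermD L e dV hdV dW hdW) v :=
    fun v hv => hT₅ v fun h5 => hv (hT (by simp only [Finset.mem_union]; exact Or.inr h5))
  -- ★ #31s: `f` factorises off `T`
  obtain ⟨-, hfac⟩ := stdFamilyFactorisable L e dV hdV hdV0 dW hdW hdW0 T χ hχT hIwT 𝒦 f hstd (hS₁ T hS₁T).1 0 (hS₁ T hS₁T).2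
  -- ★ Φ3b: the pinned splitting of `νN`
  obtain ⟨νinf, hνinf, hσ, hmap⟩ := exists_isHaarMeasure_map_unipDeltaSplit_eq_prod_pi_rpMeasure L e dV hdV dW hdW T νN νv hνK
  haveI := hνinf
  haveI := hσ
  refine ⟨νinf, hνinf, hσ, fun s hs => ?_⟩
  -- ★ O41.3: the integrand is `L¹(νN)` (the character at the index `0` is `1`)
  have hG : Integrable (fun u : ↥(unipDelta L e dV hdV dW hdW) =>
      conj (unipDeltaChar L e dV hdV dW hdW 0 (u : HA L e dV hdV dW hdW) : ℂ) * f s (weylDelta L e dV hdV dW hdW * (u : HA L e dV hdV dW hdW) * h)) νN := by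
    refine (integrable_weylDelta_mul L e dV hdV dW hdW hdV0 hdW0 hχu hs (hstd.1.1 s) (hcont s) νN h).congr (ae_of_all _ fun u => ?_)
    simp only [unipDeltaChar_zero, Circle.coe_one, map_one, one_mul]
  -- ★ Φ3d (d2) at the index `0`, `ψ_0 ≡ 1`
  have key := (whittakerDelta_eq_mul_tprod_of_isFactorizableOff L e dV hdV dW hdW T νN νv hνK νinf hmap hχT hfac s 0 hhT hwT
    (ΨT := fun _ => 1) (Ψv := fun _ _ => 1)
    (fun u => by simp only [unipDeltaChar_zero, Circle.coe_one, map_one, one_mul, finprod_one]) (fun _ _ _ _ => rfl) hG).2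
  rw [whittakerDelta_zero_index] at key
  simpa only [one_mul] using key

end Summit.HodgeConjecture.HodgeConjecture.Cruxes.HLiu418.K2LiuBigCellEulerHead

end
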